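import Summits.AtomisticToContinuum.Crystallization.Theorems.PalmUnimodularRigidityLayeredLawsSelectHcpForceBalance
import Summits.AtomisticToContinuum.Crystallization.Theorems.PalmUnimodularRigidityLayeredLawsSelectHcpRootEnergy
import Literature.Probability.Process.PointStationaryLaw
import HarnessLib

/-!
# Crux `DefectFreeCrystallizes` (stmt-AtomisticToContinuum-13603), line `palm-good-law`:
# zero mean virial stress of hard-core laws that are minimal against affine competitors

Registered stub `stub_zeroMeanStress_of_competitor` (R2a″-B) of the crux item: FERMAT FOR THE
AFFINE FAMILY.  If a probability law `P` on rooted `δ`-hard-core configurations `μ = count|S` of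
`ℝ³` has `E_P[½ ∫ V(‖y‖) dμ] ≤ E_P[½ ∫ V(‖A y‖) dμ]` for every continuous linear automorphism
`A` of `ℝ³` (`V` = Lennard-Jones), then `E_P[∫ V′(‖y‖)/‖y‖ · ⟨y, M y⟩ dμ] = 0` for every
continuous linear `M`.

Proof.  For `|t| < R := 1/(2(‖M‖ + 1))` the map `A_t = 1 + tM` is a unit of the Banach algebra
`ℝ³ →L ℝ³` (`‖tM‖ ≤ 1/2`), so `0` is a local minimum of `f(t) := E_P[½ ∫ V(‖y + tMy‖) dμ]`.
Differentiation under BOTH integrals (`hasDerivAt_integral_of_dominated_loc_of_deriv_le`,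
twice): on a `δ`-separated `S ∋ 0`, off the root `‖y + tMy‖ ≥ ‖y‖/2 ≥ δ/2`, the
`t`-derivative of `V(‖y + tMy‖)` is `V′(r)/r · ⟨y + tMy, My⟩` (`r = ‖y + tMy‖`; chain rule
through the landed `hasFDerivAt_comp_dist_left`), bounded by `((δ/2)⁻⁶ + 1)·2⁷·‖M‖·‖y‖⁻⁶`
(`|V′(r)| ≤ (ρ⁻⁶ + 1) r⁻⁷` for `r ≥ ρ`), and `∑_{y ∈ S} ‖y‖⁻⁶ ≤ 250 δ⁻⁶` (landed shell bound
`lintegral_inv_norm_pow_six_le`); the root term is the constant `V(0)`.  So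
`t ↦ ∫ V(‖y + tMy‖) dμ` is differentiable on `(-R, R)` with derivative bounded by a
deterministic `K(δ, ‖M‖)`, which is `P`-integrable (`P` is a probability measure);
measurability of `μ ↦ ∫ g dμ` is `StronglyMeasurable.integral_kernel` for the identity kernel.
`IsLocalMin.hasDerivAt_eq_zero` finishes.  [folklore; the virial / first-variation identity]
-/

noncomputable section

open MeasureTheory Metric Filter Topology
open scoped RealInnerProductSpace ENNReal

namespace Summit.AtomisticToContinuum.Crystallization.Theorems.PalmGoodLaw.ZeroMeanStress

open Literature.MathematicalPhysics.StatisticalMechanics Literature.Probability.Process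
open Summit.AtomisticToContinuum.Crystallization.Theorems.ExcessDecayLiouvilleForceBalance
  (hasFDerivAt_comp_dist_left differentiableAt_lennardJones)
open Summit.AtomisticToContinuum.Crystallization.Theorems.PhononStabilityNegative
  (deriv_lennardJones)
open Summit.AtomisticToContinuum.Crystallization.Theorems.PalmUnimodularRigidityMinimiserShells.EnergyFloor
  (lintegral_inv_norm_pow_six_le measurable_lennardJones neg_lennardJones_le lennardJones_le_of_le
    rootEnergy' rootEnergy'_eq_of_hc rootEnergy'_bounds_of_hc)
open Summit.AtomisticToContinuum.Crystallization.Theorems.MinimiserShells.Negative.Rootedness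
  (countable_of_separated)

/-! ## Pointwise calculus along the affine path `t ↦ y + tMy` -/

section Pointwise

variable (M : EuclideanSpace ℝ (Fin 3) →L[ℝ] EuclideanSpace ℝ (Fin 3))

/-- `‖y + tMy‖ ≥ ‖y‖/2` once `|t|·‖M‖ ≤ 1/2`. [folklore] -/
theorem half_norm_le_norm_affine {t : ℝ} (ht : |t| * ‖M‖ ≤ 1 / 2)
    (y : EuclideanSpace ℝ (Fin 3)) : ‖y‖ / 2 ≤ ‖y + t • M y‖ := by
  have h1 : ‖t • M y‖ ≤ ‖y‖ / 2 := by
    rw [norm_smul, Real.norm_eq_abs]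
    calc |t| * ‖M y‖ ≤ |t| * (‖M‖ * ‖y‖) :=
          mul_le_mul_of_nonneg_left (M.le_opNorm y) (abs_nonneg t)
      _ = (|t| * ‖M‖) * ‖y‖ := by ring
      _ ≤ (1 / 2) * ‖y‖ := mul_le_mul_of_nonneg_right ht (norm_nonneg y)
      _ = ‖y‖ / 2 := by ring
  have h2 : ‖y‖ ≤ ‖y + t • M y‖ + ‖t • M y‖ := by
    have := norm_sub_le (y + t • M y) (t • M y)
    rwa [add_sub_cancel_right] at this
  linarith

/-- `|V′(r)| ≤ (ρ⁻⁶ + 1)·r⁻⁷` for `r ≥ ρ > 0` (`V′ = −r⁻¹³ + r⁻⁷`). [folklore] -/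
theorem abs_deriv_lennardJones_le_inv_pow_seven {ρ r : ℝ} (hρ : 0 < ρ) (hr : ρ ≤ r) :
    |deriv lennardJones r| ≤ (ρ⁻¹ ^ 6 + 1) * r⁻¹ ^ 7 := by
  have hr0 : 0 < r := hρ.trans_le hr
  rw [deriv_lennardJones hr0.ne']
  have h0 : 0 ≤ r⁻¹ := inv_nonneg.2 hr0.le
  have h1 : r⁻¹ ≤ ρ⁻¹ := (inv_le_inv₀ hr0 hρ).2 hr
  have h6 : r⁻¹ ^ 6 ≤ ρ⁻¹ ^ 6 := pow_le_pow_left₀ h0 h1 6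
  have h7 : 0 ≤ r⁻¹ ^ 7 := pow_nonneg h0 7
  have e13 : (r⁻¹) ^ 13 = (r⁻¹) ^ 6 * (r⁻¹) ^ 7 := by ring
  calc |-(r⁻¹) ^ 13 + (r⁻¹) ^ 7| ≤ |-(r⁻¹) ^ 13| + |(r⁻¹) ^ 7| := abs_add_le _ _
    _ = (r⁻¹) ^ 6 * (r⁻¹) ^ 7 + (r⁻¹) ^ 7 := by
        rw [abs_neg, abs_of_nonneg (pow_nonneg h0 13), abs_of_nonneg h7, e13]
    _ ≤ ρ⁻¹ ^ 6 * (r⁻¹) ^ 7 + (r⁻¹) ^ 7 := by gcongr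
    _ = (ρ⁻¹ ^ 6 + 1) * r⁻¹ ^ 7 := by ring

/-- Chain rule along the affine path: `d/dt V(‖y + tMy‖) = V′(r)/r · ⟨y + tMy, My⟩`,
`r = ‖y + tMy‖ ≠ 0`. [folklore] -/
theorem hasDerivAt_lennardJones_norm_affine (y : EuclideanSpace ℝ (Fin 3)) {t : ℝ}
    (h : y + t • M y ≠ 0) :
    HasDerivAt (fun s : ℝ => lennardJones ‖y + s • M y‖)
      (deriv lennardJones ‖y + t • M y‖ / ‖y + t • M y‖ * ⟪y + t • M y, M y⟫) t := by
  have hpath : HasDerivAt (fun s : ℝ => y + s • M y) (M y) t := by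
    have := ((hasDerivAt_id t).smul_const (M y)).const_add y
    simpa using this
  have hne : ‖y + t • M y‖ ≠ 0 := norm_ne_zero_iff.2 h
  have hV : HasDerivAt lennardJones (deriv lennardJones (dist (y + t • M y) 0))
      (dist (y + t • M y) 0) := by
    rw [dist_zero_right]
    exact (differentiableAt_lennardJones hne).hasDerivAt
  have h2 := (hasFDerivAt_comp_dist_left h hV).comp_hasDerivAt t hpath
  simp only [Function.comp_def, dist_zero_right, sub_zero, smul_apply, innerSL_apply_apply,
    smul_eq_mul] at h2
  exact h2

/-- Termwise derivative bound: for `‖y‖ ≥ δ > 0` and `|t|·‖M‖ ≤ 1/2`,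
`|V′(r)/r · ⟨y + tMy, My⟩| ≤ ((δ/2)⁻⁶ + 1)·2⁷·‖M‖·‖y‖⁻⁶`. [folklore] -/
theorem abs_stressTerm_le {δ : ℝ} (hδ : 0 < δ) {t : ℝ} (ht : |t| * ‖M‖ ≤ 1 / 2)
    {y : EuclideanSpace ℝ (Fin 3)} (hy : δ ≤ ‖y‖) :
    |deriv lennardJones ‖y + t • M y‖ / ‖y + t • M y‖ * ⟪y + t • M y, M y⟫| ≤
      ((δ / 2)⁻¹ ^ 6 + 1) * 2 ^ 7 * ‖M‖ * ‖y‖⁻¹ ^ 6 := by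
  set c := y + t • M y
  have hy0 : 0 < ‖y‖ := hδ.trans_le hy
  have hhalf : ‖y‖ / 2 ≤ ‖c‖ := half_norm_le_norm_affine M ht y
  have hc0 : 0 < ‖c‖ := by linarith
  have hρ : δ / 2 ≤ ‖c‖ := by linarith
  have h1 : |deriv lennardJones ‖c‖ / ‖c‖ * ⟪c, M y⟫| ≤
      |deriv lennardJones ‖c‖| * (‖M‖ * ‖y‖) := by
    rw [abs_mul, abs_div, abs_of_pos hc0]
    have hcs : |⟪c, M y⟫| ≤ ‖c‖ * (‖M‖ * ‖y‖) :=
      (abs_real_inner_le_norm _ _).trans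
        (mul_le_mul_of_nonneg_left (M.le_opNorm y) (norm_nonneg _))
    calc |deriv lennardJones ‖c‖| / ‖c‖ * |⟪c, M y⟫|
          ≤ |deriv lennardJones ‖c‖| / ‖c‖ * (‖c‖ * (‖M‖ * ‖y‖)) := by gcongr
      _ = |deriv lennardJones ‖c‖| * (‖M‖ * ‖y‖) := by
          rw [← mul_assoc, div_mul_cancel₀ _ hc0.ne']
  have h2 := abs_deriv_lennardJones_le_inv_pow_seven (by positivity : (0 : ℝ) < δ / 2) hρ
  have h3 : ‖c‖⁻¹ ≤ 2 * ‖y‖⁻¹ := by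
    rw [← inv_inv (2 : ℝ), ← mul_inv, inv_le_inv₀ hc0 (by positivity)]
    linarith
  have h4 : ‖c‖⁻¹ ^ 7 ≤ (2 * ‖y‖⁻¹) ^ 7 := pow_le_pow_left₀ (inv_nonneg.2 hc0.le) h3 7
  have h5 : ‖y‖⁻¹ ^ 7 * ‖y‖ = ‖y‖⁻¹ ^ 6 := by
    rw [pow_succ, mul_assoc, inv_mul_cancel₀ hy0.ne', mul_one]
  calc |deriv lennardJones ‖c‖ / ‖c‖ * ⟪c, M y⟫|
        ≤ |deriv lennardJones ‖c‖| * (‖M‖ * ‖y‖) := h1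
    _ ≤ ((δ / 2)⁻¹ ^ 6 + 1) * ‖c‖⁻¹ ^ 7 * (‖M‖ * ‖y‖) := by gcongr
    _ ≤ ((δ / 2)⁻¹ ^ 6 + 1) * (2 * ‖y‖⁻¹) ^ 7 * (‖M‖ * ‖y‖) := by gcongr
    _ = ((δ / 2)⁻¹ ^ 6 + 1) * 2 ^ 7 * ‖M‖ * (‖y‖⁻¹ ^ 7 * ‖y‖) := by ring
    _ = ((δ / 2)⁻¹ ^ 6 + 1) * 2 ^ 7 * ‖M‖ * ‖y‖⁻¹ ^ 6 := by rw [h5]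

/-- Termwise value bound: for `‖y‖ ≥ δ > 0` and `|t|·‖M‖ ≤ 1/2`,
`|V(‖y + tMy‖)| ≤ ((δ/2)⁻⁶/12 + 1/6)·2⁶·‖y‖⁻⁶` (`−r⁻⁶/6 ≤ V(r) ≤ ρ⁻⁶r⁻⁶/12` for `r ≥ ρ`, landed).
[folklore] -/
theorem abs_lennardJones_affine_le {δ : ℝ} (hδ : 0 < δ) {t : ℝ} (ht : |t| * ‖M‖ ≤ 1 / 2)
    {y : EuclideanSpace ℝ (Fin 3)} (hy : δ ≤ ‖y‖) :
    |lennardJones ‖y + t • M y‖| ≤ ((δ / 2)⁻¹ ^ 6 / 12 + 1 / 6) * 2 ^ 6 * ‖y‖⁻¹ ^ 6 := by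
  set c := y + t • M y
  have hy0 : 0 < ‖y‖ := hδ.trans_le hy
  have hhalf : ‖y‖ / 2 ≤ ‖c‖ := half_norm_le_norm_affine M ht y
  have hc0 : 0 < ‖c‖ := by linarith
  have hρ : δ / 2 ≤ ‖c‖ := by linarith
  have h2 : |lennardJones ‖c‖| ≤ ((δ / 2)⁻¹ ^ 6 / 12 + 1 / 6) * ‖c‖⁻¹ ^ 6 := by
    have hup := lennardJones_le_of_le (by positivity : (0 : ℝ) < δ / 2) hρ
    have hlo := neg_lennardJones_le ‖c‖
    have h6 : 0 ≤ ‖c‖⁻¹ ^ 6 := by positivity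
    have h66 : 0 ≤ (δ / 2)⁻¹ ^ 6 * ‖c‖⁻¹ ^ 6 := by positivity
    rw [abs_le]
    constructor <;> nlinarith
  have h3 : ‖c‖⁻¹ ≤ 2 * ‖y‖⁻¹ := by
    rw [← inv_inv (2 : ℝ), ← mul_inv, inv_le_inv₀ hc0 (by positivity)]
    linarith
  have h4 : ‖c‖⁻¹ ^ 6 ≤ (2 * ‖y‖⁻¹) ^ 6 := pow_le_pow_left₀ (inv_nonneg.2 hc0.le) h3 6
  calc |lennardJones ‖c‖| ≤ ((δ / 2)⁻¹ ^ 6 / 12 + 1 / 6) * ‖c‖⁻¹ ^ 6 := h2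
    _ ≤ ((δ / 2)⁻¹ ^ 6 / 12 + 1 / 6) * (2 * ‖y‖⁻¹) ^ 6 := by gcongr
    _ = ((δ / 2)⁻¹ ^ 6 / 12 + 1 / 6) * 2 ^ 6 * ‖y‖⁻¹ ^ 6 := by ring

/-- The affine path is continuous in `y`. [folklore] -/
theorem continuous_affinePath (t : ℝ) :
    Continuous fun y : EuclideanSpace ℝ (Fin 3) => y + t • M y :=
  continuous_id.add (M.continuous.const_smul t)

/-- Measurability of the deformed pair term `y ↦ V(‖y + tMy‖)`. [folklore] -/
theorem measurable_lennardJones_affine (t : ℝ) :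
    Measurable fun y : EuclideanSpace ℝ (Fin 3) => lennardJones ‖y + t • M y‖ :=
  measurable_lennardJones.comp (continuous_affinePath M t).norm.measurable

/-- Measurability of the stress term `y ↦ V′(r)/r · ⟨y + tMy, My⟩` (`deriv` of any function is
measurable). [folklore] -/
theorem measurable_stressTerm (t : ℝ) : Measurable fun y : EuclideanSpace ℝ (Fin 3) =>
    deriv lennardJones ‖y + t • M y‖ / ‖y + t • M y‖ * ⟪y + t • M y, M y⟫ :=
  (((measurable_deriv lennardJones).comp (continuous_affinePath M t).norm.measurable).div
    (continuous_affinePath M t).norm.measurable).mul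
    ((continuous_affinePath M t).inner M.continuous).measurable

/-- `1 + tM` is a continuous linear automorphism of `ℝ³` for `|t|·‖M‖ ≤ 1/2` (a unit of the
Banach algebra `ℝ³ →L ℝ³` by the Neumann series). [folklore] -/
theorem exists_equiv_affine {t : ℝ} (ht : |t| * ‖M‖ ≤ 1 / 2) :
    ∃ A : EuclideanSpace ℝ (Fin 3) ≃L[ℝ] EuclideanSpace ℝ (Fin 3), ∀ y,
      (A : EuclideanSpace ℝ (Fin 3) →L[ℝ] EuclideanSpace ℝ (Fin 3)) y = y + t • M y := by
  have hlt : ‖-(t • M)‖ < 1 := by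
    rw [norm_neg, norm_smul, Real.norm_eq_abs]
    linarith
  refine ⟨ContinuousLinearEquiv.unitsEquiv ℝ (EuclideanSpace ℝ (Fin 3))
    (Units.oneSub (-(t • M)) hlt), fun y => ?_⟩
  rw [ContinuousLinearEquiv.coe_coe, ContinuousLinearEquiv.unitsEquiv_apply, Units.val_oneSub]
  simp [sub_neg_eq_add]

/-- `|t|·‖M‖ ≤ 1/2` for `|t| < 1/(2(‖M‖ + 1))`. [folklore] -/
theorem abs_mul_norm_le_half {t : ℝ} (ht : t ∈ ball (0 : ℝ) (1 / (2 * (‖M‖ + 1)))) :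
    |t| * ‖M‖ ≤ 1 / 2 := by
  rw [mem_ball, dist_zero_right, Real.norm_eq_abs] at ht
  have h1 : |t| * ‖M‖ ≤ 1 / (2 * (‖M‖ + 1)) * ‖M‖ :=
    mul_le_mul_of_nonneg_right ht.le (norm_nonneg M)
  have h2 : 1 / (2 * (‖M‖ + 1)) * ‖M‖ ≤ 1 / 2 := by
    rw [div_mul_eq_mul_div, one_mul, div_le_iff₀ (by positivity)]
    linarith [norm_nonneg M]
  linarith

end Pointwise

/-! ## Measurability in the configuration -/

/-- `μ ↦ ∫ g dμ` is (strongly) measurable on `Measure ℝ³` for measurable real `g`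
(`StronglyMeasurable.integral_kernel` for the identity kernel). [folklore] -/
theorem stronglyMeasurable_integral_measure {g : EuclideanSpace ℝ (Fin 3) → ℝ}
    (hg : Measurable g) :
    StronglyMeasurable fun μ : Measure (EuclideanSpace ℝ (Fin 3)) => ∫ y, g y ∂μ :=
  hg.stronglyMeasurable.integral_kernel
    (κ := (⟨fun μ => μ, measurable_id⟩ :
      ProbabilityTheory.Kernel (Measure (EuclideanSpace ℝ (Fin 3))) (EuclideanSpace ℝ (Fin 3))))

/-! ## One configuration: differentiating `t ↦ ∫ V(‖y + tMy‖) d(count|S)` -/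

section Config

variable (M : EuclideanSpace ℝ (Fin 3) →L[ℝ] EuclideanSpace ℝ (Fin 3)) {δ : ℝ}
  {S : Set (EuclideanSpace ℝ (Fin 3))}

/-- On a `δ`-separated `S ∋ 0`: `y ↦ ‖y‖⁻⁶` is `count|S`-integrable with integral `≤ 250 δ⁻⁶`.
[folklore] -/
theorem integrable_inv_norm_pow_six (hδ : 0 < δ) (h0 : (0 : EuclideanSpace ℝ (Fin 3)) ∈ S)
    (hsep : ∀ x ∈ S, ∀ y ∈ S, x ≠ y → δ ≤ dist x y) :
    Integrable (fun y : EuclideanSpace ℝ (Fin 3) => ‖y‖⁻¹ ^ 6)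
        ((Measure.count : Measure (EuclideanSpace ℝ (Fin 3))).restrict S) ∧
      ∫ y, ‖y‖⁻¹ ^ 6 ∂((Measure.count : Measure (EuclideanSpace ℝ (Fin 3))).restrict S) ≤
        250 * δ⁻¹ ^ 6 := by
  set μ := (Measure.count : Measure (EuclideanSpace ℝ (Fin 3))).restrict S
  have hmeas : Measurable fun y : EuclideanSpace ℝ (Fin 3) => ‖y‖⁻¹ ^ 6 :=
    (measurable_norm.inv).pow_const 6
  have hnn : 0 ≤ᵐ[μ] fun y : EuclideanSpace ℝ (Fin 3) => ‖y‖⁻¹ ^ 6 :=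
    ae_of_all _ fun y => by positivity
  have hlin : ∫⁻ y, ENNReal.ofReal (‖y‖⁻¹ ^ 6) ∂μ ≤ ENNReal.ofReal (250 * δ⁻¹ ^ 6) :=
    lintegral_inv_norm_pow_six_le hδ h0 hsep
  have hint : Integrable (fun y : EuclideanSpace ℝ (Fin 3) => ‖y‖⁻¹ ^ 6) μ :=
    ⟨hmeas.aestronglyMeasurable,
      (hasFiniteIntegral_iff_ofReal hnn).2 (hlin.trans_lt ENNReal.ofReal_lt_top)⟩
  refine ⟨hint, ?_⟩
  have h := ofReal_integral_eq_lintegral_ofReal hint hnn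
  have h' : ENNReal.ofReal (∫ y, ‖y‖⁻¹ ^ 6 ∂μ) ≤ ENNReal.ofReal (250 * δ⁻¹ ^ 6) := h ▸ hlin
  exact (ENNReal.ofReal_le_ofReal_iff (by positivity)).1 h'

/-- **Deterministic Fermat calculus on one configuration.**  On a `δ`-separated `S ∋ 0` and for
`|t| < 1/(2(‖M‖ + 1))`, `t ↦ ∫ V(‖y + tMy‖) d(count|S)` has derivative
`∫ V′(r)/r · ⟨y + tMy, My⟩ d(count|S)`, bounded by `((δ/2)⁻⁶ + 1)·2⁷·‖M‖·250 δ⁻⁶`.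
[folklore] -/
theorem hasDerivAt_integral_config (hδ : 0 < δ) (h0 : (0 : EuclideanSpace ℝ (Fin 3)) ∈ S)
    (hsep : ∀ x ∈ S, ∀ y ∈ S, x ≠ y → δ ≤ dist x y) {t : ℝ}
    (ht : t ∈ ball (0 : ℝ) (1 / (2 * (‖M‖ + 1)))) :
    HasDerivAt (fun s : ℝ => ∫ y, lennardJones ‖y + s • M y‖
        ∂((Measure.count : Measure (EuclideanSpace ℝ (Fin 3))).restrict S))
        (∫ y, deriv lennardJones ‖y + t • M y‖ / ‖y + t • M y‖ * ⟪y + t • M y, M y⟫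
          ∂((Measure.count : Measure (EuclideanSpace ℝ (Fin 3))).restrict S)) t ∧
      |∫ y, deriv lennardJones ‖y + t • M y‖ / ‖y + t • M y‖ * ⟪y + t • M y, M y⟫
          ∂((Measure.count : Measure (EuclideanSpace ℝ (Fin 3))).restrict S)| ≤
        ((δ / 2)⁻¹ ^ 6 + 1) * 2 ^ 7 * ‖M‖ * (250 * δ⁻¹ ^ 6) := by
  set μ := (Measure.count : Measure (EuclideanSpace ℝ (Fin 3))).restrict S
  set R : ℝ := 1 / (2 * (‖M‖ + 1))
  set K₁ : ℝ := ((δ / 2)⁻¹ ^ 6 + 1) * 2 ^ 7 * ‖M‖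
  set K₂ : ℝ := ((δ / 2)⁻¹ ^ 6 / 12 + 1 / 6) * 2 ^ 6
  have hsmall : ∀ s ∈ ball (0 : ℝ) R, |s| * ‖M‖ ≤ 1 / 2 := fun s hs => abs_mul_norm_le_half M hs
  obtain ⟨hint6, hle6⟩ := integrable_inv_norm_pow_six hδ h0 hsep
  have hmemS : ∀ᵐ y ∂μ, y ∈ S :=
    ae_restrict_mem (countable_of_separated hδ hsep).measurableSet
  have hdich : ∀ y ∈ S, y = 0 ∨ δ ≤ ‖y‖ := fun y hy => (eq_or_ne y 0).imp_right fun hy0 => by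
    simpa only [dist_zero_right] using hsep y hy 0 h0 hy0
  have hbound : ∀ᵐ y ∂μ, ∀ s ∈ ball (0 : ℝ) R,
      ‖deriv lennardJones ‖y + s • M y‖ / ‖y + s • M y‖ * ⟪y + s • M y, M y⟫‖ ≤
        K₁ * ‖y‖⁻¹ ^ 6 := by
    filter_upwards [hmemS] with y hy s hs
    rw [Real.norm_eq_abs]
    rcases hdich y hy with rfl | hy'
    · simp
    · exact abs_stressTerm_le M hδ (hsmall s hs) hy'
  have hdiff : ∀ᵐ y ∂μ, ∀ s ∈ ball (0 : ℝ) R,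
      HasDerivAt (fun s : ℝ => lennardJones ‖y + s • M y‖)
        (deriv lennardJones ‖y + s • M y‖ / ‖y + s • M y‖ * ⟪y + s • M y, M y⟫) s := by
    filter_upwards [hmemS] with y hy s hs
    rcases hdich y hy with rfl | hy'
    · simp only [map_zero, smul_zero, add_zero, norm_zero, inner_zero_left, mul_zero]
      exact hasDerivAt_const s _
    · refine hasDerivAt_lennardJones_norm_affine M y ?_
      have hy0 : 0 < ‖y‖ := hδ.trans_le hy'
      have hh := half_norm_le_norm_affine M (hsmall s hs) y
      intro h
      rw [h, norm_zero] at hh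
      linarith
  have hFint : Integrable (fun y => lennardJones ‖y + t • M y‖) μ := by
    refine Integrable.mono' (hint6.const_mul K₂)
      (measurable_lennardJones_affine M t).aestronglyMeasurable ?_
    filter_upwards [hmemS] with y hy
    rw [Real.norm_eq_abs]
    rcases hdich y hy with rfl | hy'
    · simp [lennardJones_zero]
    · exact abs_lennardJones_affine_le M hδ (hsmall t ht) hy'
  have hkey := hasDerivAt_integral_of_dominated_loc_of_deriv_le (μ := μ)
    (F := fun (s : ℝ) (y : EuclideanSpace ℝ (Fin 3)) => lennardJones ‖y + s • M y‖)
    (F' := fun (s : ℝ) (y : EuclideanSpace ℝ (Fin 3)) =>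
      deriv lennardJones ‖y + s • M y‖ / ‖y + s • M y‖ * ⟪y + s • M y, M y⟫)
    (bound := fun y => K₁ * ‖y‖⁻¹ ^ 6) (isOpen_ball.mem_nhds ht)
    (Eventually.of_forall fun s => (measurable_lennardJones_affine M s).aestronglyMeasurable)
    hFint (measurable_stressTerm M t).aestronglyMeasurable hbound (hint6.const_mul K₁) hdiff
  refine ⟨hkey.2, ?_⟩
  have hK₁0 : 0 ≤ K₁ := by positivity
  have h1 : ‖∫ y, deriv lennardJones ‖y + t • M y‖ / ‖y + t • M y‖ * ⟪y + t • M y, M y⟫ ∂μ‖ ≤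
      ∫ y, K₁ * ‖y‖⁻¹ ^ 6 ∂μ :=
    norm_integral_le_of_norm_le (hint6.const_mul K₁) (hbound.mono fun y hy => hy t ht)
  rw [Real.norm_eq_abs, integral_const_mul] at h1
  exact h1.trans (mul_le_mul_of_nonneg_left hle6 hK₁0)

end Config

/-! ## The law level: Fermat under the `P`-integral -/

/-- **Registered stub `stub_zeroMeanStress_of_competitor` (R2a″-B).**  FERMAT FOR THE AFFINE
FAMILY: if a probability law `P` on rooted `δ`-hard-core configurations has
`E_P[½ ∫ V(‖y‖) dμ] ≤ E_P[½ ∫ V(‖A y‖) dμ]` for every continuous linear automorphism `A` of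
`ℝ³`, then its mean virial stress vanishes: `E_P[∫ V′(‖y‖)/‖y‖ · ⟨y, M y⟩ dμ] = 0` for every
continuous linear `M`. [folklore] -/
theorem stub_zeroMeanStress_of_competitor :
    ∀ δ : ℝ, 0 < δ → ∀ P : Measure (Measure (EuclideanSpace ℝ (Fin 3))), IsProbabilityMeasure P →
      (∀ᵐ μ ∂P, IsRootedHardCore δ μ) →
      (∀ A : EuclideanSpace ℝ (Fin 3) ≃L[ℝ] EuclideanSpace ℝ (Fin 3),
        ∫ μ, (∫ y, lennardJones ‖y‖ ∂μ) / 2 ∂P ≤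
          ∫ μ, (∫ y, lennardJones ‖(A : EuclideanSpace ℝ (Fin 3) →L[ℝ] EuclideanSpace ℝ (Fin 3)) y‖ ∂μ) / 2 ∂P) →
      ∀ M : EuclideanSpace ℝ (Fin 3) →L[ℝ] EuclideanSpace ℝ (Fin 3),
        ∫ μ, (∫ y, deriv lennardJones ‖y‖ / ‖y‖ * inner ℝ y (M y) ∂μ) ∂P = 0 := by
  intro δ hδ P hP hcore hmin M
  set R : ℝ := 1 / (2 * (‖M‖ + 1))
  have hRpos : 0 < R := by positivity
  set K : ℝ := ((δ / 2)⁻¹ ^ 6 + 1) * 2 ^ 7 * ‖M‖ * (250 * δ⁻¹ ^ 6)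
  set F : ℝ → Measure (EuclideanSpace ℝ (Fin 3)) → ℝ := fun t μ =>
    ∫ y, lennardJones ‖y + t • M y‖ ∂μ with hF
  set F' : ℝ → Measure (EuclideanSpace ℝ (Fin 3)) → ℝ := fun t μ =>
    ∫ y, deriv lennardJones ‖y + t • M y‖ / ‖y + t • M y‖ * ⟪y + t • M y, M y⟫ ∂μ with hF'
  have hF_meas : ∀ t, AEStronglyMeasurable (F t) P := fun t =>
    (stronglyMeasurable_integral_measure (measurable_lennardJones_affine M t)).aestronglyMeasurable
  have hF'_meas : ∀ t, AEStronglyMeasurable (F' t) P := fun t =>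
    (stronglyMeasurable_integral_measure (measurable_stressTerm M t)).aestronglyMeasurable
  have hF0 : ∀ μ, F 0 μ = ∫ y, lennardJones ‖y‖ ∂μ := fun μ => by
    simp only [hF, zero_smul, add_zero]
  have hF'0 : ∀ μ, F' 0 μ = ∫ y, deriv lennardJones ‖y‖ / ‖y‖ * ⟪y, M y⟫ ∂μ := fun μ => by
    simp only [hF', zero_smul, add_zero]
  -- integrability of `F 0` : bounded on the hard-core class
  have hF_int : Integrable (F 0) P := by
    refine Integrable.mono'
      (integrable_const (2 * (250 / 12 * δ⁻¹ ^ 6 + 250 / 24 * δ⁻¹ ^ 12))) (hF_meas 0) ?_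
    filter_upwards [hcore] with μ hμ
    rw [hF0, Real.norm_eq_abs]
    have heq := rootEnergy'_eq_of_hc hδ hμ
    have hb := rootEnergy'_bounds_of_hc hδ hμ
    have h2 : ∫ y, lennardJones ‖y‖ ∂μ = 2 * rootEnergy' μ := by rw [heq]; ring
    rw [h2, abs_le]
    have h6 : (0 : ℝ) ≤ 250 / 12 * δ⁻¹ ^ 6 := by positivity
    have h12 : (0 : ℝ) ≤ 250 / 24 * δ⁻¹ ^ 12 := by positivity
    constructor <;> nlinarith [hb.1, hb.2]
  -- a.e. differentiability in `t` with the deterministic derivative bound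
  have hconf : ∀ᵐ μ ∂P, ∀ t ∈ ball (0 : ℝ) R,
      HasDerivAt (fun s => F s μ) (F' t μ) t ∧ ‖F' t μ‖ ≤ K := by
    filter_upwards [hcore] with μ hμ t ht
    obtain ⟨S, h0, hsep, rfl⟩ := hμ
    obtain ⟨h1, h2⟩ := hasDerivAt_integral_config M hδ h0 hsep ht
    exact ⟨h1, by rw [Real.norm_eq_abs]; exact h2⟩
  have hderiv : HasDerivAt (fun t => ∫ μ, F t μ ∂P) (∫ μ, F' 0 μ ∂P) 0 :=
    (hasDerivAt_integral_of_dominated_loc_of_deriv_le (μ := P) (F := F) (F' := F')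
      (bound := fun _ => K) (ball_mem_nhds (0 : ℝ) hRpos) (Eventually.of_forall hF_meas) hF_int
      (hF'_meas 0) (hconf.mono fun μ hμ t ht => (hμ t ht).2) (integrable_const K)
      (hconf.mono fun μ hμ t ht => (hμ t ht).1)).2
  have hderiv2 : HasDerivAt (fun t => ∫ μ, F t μ / 2 ∂P) ((∫ μ, F' 0 μ ∂P) / 2) 0 := by
    refine (hderiv.div_const 2).congr_of_eventuallyEq (Eventually.of_forall fun t => ?_)
    exact integral_div 2 (F t)
  -- `0` is a local minimum of `t ↦ E_P[½ ∫ V(‖y + tMy‖) dμ]`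
  have hlocmin : IsLocalMin (fun t => ∫ μ, F t μ / 2 ∂P) 0 := by
    refine Filter.eventually_of_mem (ball_mem_nhds (0 : ℝ) hRpos) fun t ht => ?_
    obtain ⟨A, hA⟩ := exists_equiv_affine M (abs_mul_norm_le_half M ht)
    have h := hmin A
    simp only [hA] at h
    show ∫ μ, F 0 μ / 2 ∂P ≤ ∫ μ, F t μ / 2 ∂P
    simp only [hF0]
    exact h
  have hzero : (∫ μ, F' 0 μ ∂P) / 2 = 0 := hlocmin.hasDerivAt_eq_zero hderiv2
  have hzero' : ∫ μ, F' 0 μ ∂P = 0 := by linarith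
  simpa only [hF'0] using hzero'

end Summit.AtomisticToContinuum.Crystallization.Theorems.PalmGoodLaw.ZeroMeanStress

end
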